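import Literature.MathematicalPhysics.QuantumFieldTheory.Balaban1983to89.B14NodeKnitRepTower

/-!
# `Balaban1983to89.B14NodeKnitRepTowerLF` — YM-DAG node N11 · [Balaban1988Convergent] CMP **119** (1988) 243–285, Theorem 1 p. 262
# (with the Theorem of p. 245 and the ASSUMED operation 𝐑 of p. 244): the represented-tower knit IN THE TREE'S OWN §2 CURRENCY — `Laws k` :=
# «represented ∧ `Step.LFHyp T c k` ∧ `Step.LFHypImproved T c βc k`», `LawsT k` := «T-represented ∧ the PRE-𝐑 new-term obligations of p. 279»
# (`Step.LFNewTerms`-shaped) — with the T-HALF (Theorem p. 245) and the 𝐑-HALF (p. 244) of `Step.LFStepObligation` SEPARATED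

statement-level bookkeeping over published theorems with citation tags; kernel-checked compositions of tree theorems;
nothing here is a claim about the Yang–Mills mass gap.

CITATION HEADER (lean-in-tree rule).  Source: T. Bałaban, *Convergent renormalization expansions for lattice gauge theories*,
Commun. Math. Phys. **119**, 243–285 (1988), doi:10.1007/bf01217741 [Balaban1988Convergent] (cell paper B14 = «[III]»).  Seat
`pub-ymgap-dag-n11-a` (YM-PLAN Track A, HUMAN RULING D-0062: the KNIT-BY-NAME seat of node N11; R420 ∕ R422 ∕ R424 ∕ R434 ∕ R437).
BY NAME and UNCHANGED: `…B14NodeKnitRepTower` (`b14_main_of_propTower`), the pre-cell module `…Step` (cell pub-balaban: `LFTower`, `LFConsts`,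
`LFHyp`, `LFHypImproved`, `LFNewTerms`, `LFSigns`, `LFHyp.succ`, `LFHyp.zero`, `LFHypImproved.zero`, `LFStepObligation`, `B14Thm1Shape`),
`…Dag` (`B14_main` :224), `…DagBinding` (`leavesP`, `WorldP`).

WHY THIS FILE (pub-ymgap chair R437: NODE 00 Stage ₉ carries the REPRESENTED TOWER; [III] Thm 1 p. 262: the densities «have the form, and
satisfy all the conditions AND BOUNDS, described in Sect. 2»).  The tree ALREADY types §2's conditions and bounds as predicates on a CARRIED
term tower — `Step.LFTower` (terms `𝐄^{(j)}(X,z,g,·)`, `𝐑^{(j)}(X,·)`, `𝐁^{(j)}(X,·,a)` with the spaces (2.34)–(2.39)), `Step.LFHyp T c k` (the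
cumulative hypotheses at index `k`: (0.20), (2.27)(i)(ii)(iv), (2.31), (2.42) — the BOUNDS as fields `boundE ∕ boundR ∕ boundB`),
`Step.LFHypImproved T c βc k` (p. 262 «after T, before 𝐑»: the newest terms in the improved spaces), `Step.LFNewTerms T c βc k` (what the step
`k → k+1` creates) — and reads Thm 1's conclusion as `Repr218 k ∧ LFHyp T c k ∧ LFHypImproved T c βc k` (`Step.B14Thm1Shape`).  Its per-step form
`Step.LFStepObligation` bundles 𝐑T.  N11's OWN content is the T-half; the 𝐑-half is the assumed property of p. 244 (node N13's product).  This
file states the represented-tower knit of `B14NodeKnitRepTower` with the law families FIXED to that currency and the two halves SEPARATED: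
(S1ᵀ) «Repr k ∧ LFHyp k ∧ LFHypImproved k ⟹ ReprT k ∧ NewT k» — THE THEOREM OF p. 245 ([III] §1 for k = 0, §3 + Thm 2 for k ≥ 1: Tρ_k is
T-represented and its new terms 𝐄^{(k+1)}, 𝐑″^{(k+1)}, 𝐁^{(k+1)} obey the PRE-𝐑 obligations `NewT k`, p. 279: «These terms satisfy all the conditions
of the inductive assumption … they are not the terms in the k+1-st effective action, because we have to perform yet the 𝐑-operation»), GIVEN the
node's antecedents; (𝐑) «ReprT k ∧ NewT k ⟹ Repr (k+1) ∧ LFNewTerms T c βc k» — 𝐑 re-organises the T-representation into the (2.18) form with index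
k+1 and its FINAL new terms obey `Step.LFNewTerms` ([III] p. 244; [Balaban1989LargeFieldI]∕[II]); the passage of the BOUNDS from index k to k+1 is
the tree's PROVED bookkeeping `LFHyp.succ` + `LFNewTerms.improved` under the sign conditions `LFSigns` (`laws_succ_of_newTerms`).  So a
`stub_N11` over Stage ₉ in this currency has body (S0) + (S1ᵀ), and the -b lane's [III] §3 estimates land as proofs of the pre-𝐑 obligations `NewT k`
(`LFNewTerms`-shaped fields for 𝐄^{(k+1)}, 𝐑″^{(k+1)}, 𝐁^{(k+1)}).

WHAT THIS FILE PROVES (0 `sorry`, 0 `def`, standard axioms).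
`laws_succ_of_newTerms` (the index shift of the bounds: `LFHyp k → LFNewTerms k → signs → LFHyp (k+1) ∧ LFHypImproved (k+1)`, by name);
**`b14_main_of_repTower_lf`** (N11 at `(w, P)` from: the §2 reading `hS`, the signs under the interval hypothesis, (S0) `Repr 0`, (S1ᵀ) with PRE-𝐑 new-term
obligations `NewT`, (𝐑) delivering `Repr (k+1) ∧ LFNewTerms`); `b14_main_of_repTower_lf₁` (single-tower reading: `NewT := LFNewTerms T c βc`);
`b14_main_of_repTower_lf_eval` (the same under the Stage-₉ reading `Sect2Form k ↔ ρ_k = eval rep_k ∧ (Repr k ∧ LFHyp k ∧ LFHypImproved k)`);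
`lfStepObligation_of_halves` (the two halves recombine to `Step.LFStepObligation` — so `B14NodeKnit.b14_main_of_lfStepObligation` is the same knit);
`b14Thm1Shape_of_halves` (with a represented start and the signs: `Step.B14Thm1Shape`, by `Step.B14Thm1Shape_of_obligation`).

HONEST FRAMING.  A count-neutral SLOT landing (R429 (4)(i)): N11 is NOT discharged; (S1ᵀ) = Sects. 1–3 + Thm 2 of [Balaban1988Convergent] is a
displayed hypothesis; (𝐑) is the printed ASSUMPTION of p. 244; the term tower `T`, the representation predicates `Repr`∕`ReprT` and the
constants are parameters (NODE 00 Stage ₉ supplies them).  One finite four-torus programme at fixed `ε`, Bałaban AS PRINTED with locators;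
nothing continuum ∕ ℝ⁴ ∕ OS ∕ mass gap ∕ Clay.
-/

noncomputable section

namespace Literature.MathematicalPhysics.QuantumFieldTheory.Balaban1983to89.B14NodeKnitRepTowerLF

open DagBinding Step
open B14NodeKnitRepTower (b14_main_of_propTower)

variable (w : WorldP) (P : B12.RunParams)
variable {G : Type*} [GaugeGroup G] {Φ 𝒢 𝔄 : Type*} {Pₛ : Params}
variable (T : LFTower Pₛ G Φ 𝒢 𝔄) (c : LFConsts) (βc : ℝ)

/-- **The index shift of §2's bounds is bookkeeping** ([Balaban1988Convergent] p. 262: *«the expressions with indices j < k are exactly as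
described above»*): the cumulative hypotheses at `k`, the new-term obligations of the step `k → k+1` and the sign conditions up to `K ≥ k+1` give
the cumulative hypotheses AND the improved newest-term bounds at `k+1` (`Step.LFHyp.succ`, `Step.LFNewTerms.improved`, by name).
[cite: Balaban1988Convergent, p.262 (bookkeeping)] -/
theorem laws_succ_of_newTerms {K k : ℕ} (hk : k < K) (hsg : LFSigns T c βc K) (h : LFHyp T c k) (hn : LFNewTerms T c βc k) :
    LFHyp T c (k + 1) ∧ LFHypImproved T c βc (k + 1) :=
  ⟨h.succ hn hsg.hβ hsg.hκ hsg.hE₀ hsg.hB₀ (hsg.hg (k + 1) hk), hn.improved⟩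

/-- **N11 OVER A REPRESENTED TOWER IN THE TREE'S §2 CURRENCY, T-HALF AND 𝐑-HALF SEPARATED** ([Balaban1988Convergent] Thm 1 p. 262 with the
Theorem of p. 245 and the assumed 𝐑 of p. 244).  Data: the (post-𝐑) term tower `T : Step.LFTower` with constants `c`, `βc`; representation
predicates `Repr k` («ρ_k has the (2.18) form with index k», post-𝐑) and `ReprT k` («Tρ_k is represented as on p. 279 ∕ (3.1)», pre-𝐑); the PRE-𝐑
new-term obligations `NewT k` (p. 279: *«Thus we have finished the decomposition … into the sum of the three terms: 𝐄^{(k+1)}, 𝐑″^{(k+1)}, and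
𝐁^{(k+1)}. These terms satisfy all the conditions of the inductive assumption. Let us remark that they are not the terms in the k+1-st effective
action, because we have to perform yet the 𝐑-operation»* — e.g. `Step.LFNewTerms T″ c βc k` for the pre-𝐑 term tower of `B14Def3p279Step`); the
§2-form clause of the run implied by «represented ∧ cumulative bounds ∧ improved newest bounds» (`hS` — Thm 1's conclusion as `Step.B14Thm1Shape`
reads it, BOUNDS INCLUDED); the sign conditions under the interval hypothesis (`hsg`).  Slots: (S0) `h0` the Wilson start is represented (no terms:
`LFHyp.zero`, `LFHypImproved.zero`); (S1ᵀ) `hT` THE THEOREM OF p. 245 — GIVEN the in-edges `b7 … b11`, the interval hypothesis, the small-field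
inductive assumptions and the flow control (2.6): for `k < K`, a represented `ρ_k` whose terms obey the cumulative and improved bounds has a
T-represented transform whose new terms obey the pre-𝐑 obligations ([III] §1 for k = 0; §3 + Thm 2 for k ≥ 1); (𝐑) `hR` — GIVEN the `rOperation`
leaf — 𝐑 turns it into a (2.18)-represented density with index k+1 whose FINAL new terms `𝐄^{(k+1)}, 𝐑^{(k+1)}, 𝐁^{(k+1)}` obey `Step.LFNewTerms T c
βc k` (p. 279: *«Obviously in general new terms will be included into 𝐑^{(k+1)}»*; [III] p. 244's assumption, [Balaban1989LargeFieldI∕II]'s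
theorem).  The bounds' index shift after 𝐑 is `laws_succ_of_newTerms`. [cite: Balaban1988Convergent, Thm 1 p.262; Theorem p.245; p.279; pp.258–262; p.244] -/
theorem b14_main_of_repTower_lf (Repr ReprT NewT : ℕ → Prop)
    (hS : ∀ k, k ≤ P.K → Repr k → LFHyp T c k → LFHypImproved T c βc k → (w.C P).Sect2Form k)
    (hsg : (leavesP w P).smallCouplings → LFSigns T c βc P.K)
    (h0 : (leavesP w P).smallCouplings → Repr 0)
    (hT : (leavesP w P).b7 → (leavesP w P).b8 → (leavesP w P).b9 → (leavesP w P).b10 → (leavesP w P).b11 →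
      (leavesP w P).smallCouplings → (leavesP w P).smallFieldInductive → (leavesP w P).flowControl →
        ∀ k, k < P.K → Repr k → LFHyp T c k → LFHypImproved T c βc k → ReprT k ∧ NewT k)
    (hR : (leavesP w P).rOperation → ∀ k, k < P.K → ReprT k → NewT k → Repr (k + 1) ∧ LFNewTerms T c βc k) :
    Dag.B14_main (leavesP w P) := by
  refine b14_main_of_propTower w P (fun k => Repr k ∧ LFHyp T c k ∧ LFHypImproved T c βc k)
    (fun k => ReprT k ∧ NewT k ∧ LFHyp T c k ∧ (leavesP w P).smallCouplings) ?_ ?_ ?_ ?_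
  · exact fun k hk h => hS k hk h.1 h.2.1 h.2.2
  · exact fun hsc => ⟨h0 hsc, LFHyp.zero T c, LFHypImproved.zero T c βc⟩
  · intro h7 h8 h9 h10 h11 hsc hsf hfc k hk h
    obtain ⟨hr', hn⟩ := hT h7 h8 h9 h10 h11 hsc hsf hfc k hk h.1 h.2.1 h.2.2
    exact ⟨hr', hn, h.2.1, hsc⟩
  · intro hrop k hk h
    obtain ⟨hr', hn, hl, hsc⟩ := h
    obtain ⟨hr1, hnew⟩ := hR hrop k hk hr' hn
    exact ⟨hr1, laws_succ_of_newTerms T c βc hk (hsg hsc) hl hnew⟩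

/-- **Single-tower reading** (the typing of `Step.LFStepObligation`, which bundles 𝐑T over ONE term tower): the T-half already delivers the new-term
obligations of `T` itself (`NewT k := LFNewTerms T c βc k`) and the 𝐑-half only re-organises the representation (`ReprT k → LFNewTerms k → Repr
(k+1)`).  Appropriate when the carried tower's `T.R (k+1)` is read as the pre-𝐑 `𝐑″^{(k+1)}` of p. 279 or when 𝐑's additions are booked inside
`Repr (k+1)`. [cite: Balaban1988Convergent, Thm 1 p.262; Theorem p.245; p.279; p.244] -/
theorem b14_main_of_repTower_lf₁ (Repr ReprT : ℕ → Prop)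
    (hS : ∀ k, k ≤ P.K → Repr k → LFHyp T c k → LFHypImproved T c βc k → (w.C P).Sect2Form k)
    (hsg : (leavesP w P).smallCouplings → LFSigns T c βc P.K)
    (h0 : (leavesP w P).smallCouplings → Repr 0)
    (hT : (leavesP w P).b7 → (leavesP w P).b8 → (leavesP w P).b9 → (leavesP w P).b10 → (leavesP w P).b11 →
      (leavesP w P).smallCouplings → (leavesP w P).smallFieldInductive → (leavesP w P).flowControl →
        ∀ k, k < P.K → Repr k → LFHyp T c k → LFHypImproved T c βc k → ReprT k ∧ LFNewTerms T c βc k)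
    (hR : (leavesP w P).rOperation → ∀ k, k < P.K → ReprT k → LFNewTerms T c βc k → Repr (k + 1)) :
    Dag.B14_main (leavesP w P) :=
  b14_main_of_repTower_lf w P T c βc Repr ReprT (fun k => LFNewTerms T c βc k) hS hsg h0 hT
    fun hrop k hk hr' hn => ⟨hR hrop k hk hr' hn, hn⟩

variable {Rep : ℕ → Type*} (rep : (k : ℕ) → Rep k) (eval : (k : ℕ) → Rep k → ((w.C P).Cfg k → ℝ))

/-- The same UNDER THE STAGE-₉ READING of the §2-form clause with the laws in the tree's currency: `ρ_k = eval rep_k` (`hρ`) and `Sect2Form k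
↔ ρ_k = eval rep_k ∧ (Repr k ∧ LFHyp T c k ∧ LFHypImproved T c βc k)` (`hS9`) — Thm 1's «form, conditions and bounds» verbatim, bounds included.
Then N11 at `(w, P)` needs exactly the signs, (S0), (S1ᵀ) and (𝐑). [cite: Balaban1988Convergent, Thm 1 p.262; Theorem p.245; p.279; p.244] -/
theorem b14_main_of_repTower_lf_eval (Repr ReprT NewT : ℕ → Prop) (hρ : ∀ k, (w.C P).ρ k = eval k (rep k))
    (hS9 : ∀ k, k ≤ P.K →
      ((w.C P).Sect2Form k ↔ ((w.C P).ρ k = eval k (rep k) ∧ (Repr k ∧ LFHyp T c k ∧ LFHypImproved T c βc k))))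
    (hsg : (leavesP w P).smallCouplings → LFSigns T c βc P.K)
    (h0 : (leavesP w P).smallCouplings → Repr 0)
    (hT : (leavesP w P).b7 → (leavesP w P).b8 → (leavesP w P).b9 → (leavesP w P).b10 → (leavesP w P).b11 →
      (leavesP w P).smallCouplings → (leavesP w P).smallFieldInductive → (leavesP w P).flowControl →
        ∀ k, k < P.K → Repr k → LFHyp T c k → LFHypImproved T c βc k → ReprT k ∧ NewT k)
    (hR : (leavesP w P).rOperation → ∀ k, k < P.K → ReprT k → NewT k → Repr (k + 1) ∧ LFNewTerms T c βc k) :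
    Dag.B14_main (leavesP w P) :=
  b14_main_of_repTower_lf w P T c βc Repr ReprT NewT
    (fun k hk hr h1 h2 => (hS9 k hk).2 ⟨hρ k, hr, h1, h2⟩) hsg h0 hT hR

/-- **The two halves recombine to the tree's per-step obligation** `Step.LFStepObligation H033 Repr T c βc K` (B14 p. 262: *«the operation 𝐑T
transforms the space with the index k into the space with the index k+1»*): T-half (Theorem p. 245, pre-𝐑 obligations `NewT`) then 𝐑-half
(p. 244, final obligations `LFNewTerms`).  Hence `B14NodeKnit.b14_main_of_lfStepObligation` (the tower-currency knit) and `b14_main_of_repTower_lf`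
are the same knit, the latter with the node's `rOperation` leaf feeding the 𝐑-half only. [cite: Balaban1988Convergent, Thm 1 and remarks p.262; Theorem p.245; p.279; p.244] -/
theorem lfStepObligation_of_halves (H033 : Flow → ℕ → Prop) (Repr ReprT NewT : ℕ → Prop) (K : ℕ)
    (hT : T.flow.SatisfiesRG K → H033 T.flow K →
      ∀ k, k < K → Repr k → LFHyp T c k → LFHypImproved T c βc k → ReprT k ∧ NewT k)
    (hR : ∀ k, k < K → ReprT k → NewT k → Repr (k + 1) ∧ LFNewTerms T c βc k) :
    LFStepObligation H033 Repr T c βc K := by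
  intro hrg h033 k hk hr h1 h2
  obtain ⟨hr', hn⟩ := hT hrg h033 k hk hr h1 h2
  exact hR k hk hr' hn

/-- … and with a represented start and the signs they give Thm 1's shape `Step.B14Thm1Shape` (`Step.B14Thm1Shape_of_obligation`, by name):
`∀ k ≤ K, Repr k ∧ LFHyp T c k ∧ LFHypImproved T c βc k` under (0.20) and `H033`. [cite: Balaban1988Convergent, Thm 1 p.262] -/
theorem b14Thm1Shape_of_halves (H033 : Flow → ℕ → Prop) (Repr ReprT NewT : ℕ → Prop) (K : ℕ) (h0 : Repr 0)
    (hsg : LFSigns T c βc K)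
    (hT : T.flow.SatisfiesRG K → H033 T.flow K →
      ∀ k, k < K → Repr k → LFHyp T c k → LFHypImproved T c βc k → ReprT k ∧ NewT k)
    (hR : ∀ k, k < K → ReprT k → NewT k → Repr (k + 1) ∧ LFNewTerms T c βc k) :
    B14Thm1Shape H033 Repr T c βc K :=
  B14Thm1Shape_of_obligation H033 Repr T c βc K h0 hsg (lfStepObligation_of_halves T c βc H033 Repr ReprT NewT K hT hR)

end Literature.MathematicalPhysics.QuantumFieldTheory.Balaban1983to89.B14NodeKnitRepTowerLF

end
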